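import Summits.HodgeConjecture.HodgeConjecture.Theorems.K2E4ArchPartnerWallJumpOrbitMeasure   -- ★ p854992 G1b: the per-partner jumps (compact ∕ noncompact), orbit-measure currency
import Summits.HodgeConjecture.HodgeConjecture.Theorems.K2E4ArchGStateStepCalculus           -- ★ p855021 G3-calc: the summed flat-factor step
import HarnessLib

/-!
# The `G′`-STATE ONE-STEP LAW of the endoscopic singular transfer at `∞`: the κ-weighted sum over the global relabellings `ρ : W → S₃` of «explicit factor × orbit-measure state»
# moves one place to the `H`-wall (Rogawski 1990 Prop. 8.2.1 (a) pp. 118–119, §8.2 pp. 122–124, §14.5 Lemma 14.5.2 (b) pp. 238–239)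

Cell `pub/hodgecm-mathlib`, Track B «K2-LIT», engine K2·E4, sockets #11 `sig_K2E4ArchSingularKernel` ∕ #9 `sig_K2E4ExplicitArchSingularTransfer` (crux H413 =
`stmt-HodgeConjecture-24833`); brick G3-step of the V2 «G′ PACKAGE» (K2E4-p11 for the assembler K2E4-p09; lands `--supports stmt-HodgeConjecture-24833`).

WHAT.  The `G′`-state family of the joint place induction (★ `K2E4ArchSingularKernelPlaceInduction.eq_of_step_of_regular_eq_splitCurve`) is, at processed places `S` and torus data `u`,
`B(S, u) = Σ_{ρ : W → S₃} Φ_ρ(S, u) · ∫ Θ ↑↑(e⁻¹ o) d(⊗_v μ_ρ(S, u)_v)` — one orbit-measure state of ★ (R1-e′) per global relabelling, weighted by the explicit factor `Φ_ρ = (const) · Δ″(γ_H, t(z∘ρ)) ·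
Π_{v∈S} κ_v(ρ_v)`.  Along the wall curve at an unprocessed place `w` the measure families are updated at `w` by the regular orbit measure of the curve point (all other places FIXED), and
the weights are `a_ρ · σ(ψ)` with ONE even `C¹` factor `σ` (★ G2 `K2E4ArchWallDeltaFactor.exists_wallDeltaFactor`).  **`tendsto_deriv_gState_step`**: for ANY families `μ_ρ` of Radon
measures (indexed by the global relabelling `ρ`), any weights `a_ρ`, any even `C¹` `σ`, and the noncompact constants `c τ` HANDED IN with the per-partner clause they satisfy (★ G1b
`exists_const_tendsto_deriv_wallJump_partner_noncompact_orbitMeasure`, clause-threaded as in ★ `wallCoef_hstep_of_clause` so that the constants stay nameable across files):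
`∂_ψ[2 sin ψ · Σ_ρ (a_ρ σ ψ) · I(μ_ρ[w ↦ ν.map conj_{diag(z₀^ψ ∘ ρ_w)}])] ⟶ Σ_ρ a_ρ σ(0) · (cpt(ρ_w) ? 2 · I(μ_ρ[w ↦ ν.map conj_{diag(z₀∘ρ_w)}]) : c(ρ_w) · I(μ_ρ[w ↦ μ^{sing}_{ρ_w}]))` along `𝓝[>] 0`
— ★ G1b per partner (compact: `tendsto_deriv_wallJump_partner_compact_orbitMeasure`; noncompact: the clause) fed to ★ G3-calc `tendsto_deriv_two_sin_mul_sum_flat_mul`.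
The concrete `B` (its measure families, weights, the (reg) identity with ★ (β)∕(3G) and the explicit all-wall state) is the sequel `K2E4ArchWallJumpValue`.
HONEST LABEL: HC_CM is proved only modulo the 7 printed citations (2 remaining named inputs: hLiu418 = stmt-HodgeConjecture-24832, h413 = stmt-HodgeConjecture-24833) until rung 0
closes; bookkeeping over ★ G1b ∕ ★ G3-calc, pays nothing by itself.

## References
* [Rogawski1990] J. D. Rogawski, *Automorphic Representations of Unitary Groups in Three Variables*, Ann. of Math. Stud. 123 (1990), Prop. 8.2.1 (a) pp. 118–119, §8.2 pp. 122–124,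
  §14.5 Lemma 14.5.2 (b) pp. 238–239.
* [Varadarajan1989] V. S. Varadarajan, *An Introduction to Harmonic Analysis on Semisimple Lie Groups* (1989), §6.4 Thm 22.
-/

set_option autoImplicit false
set_option linter.dupNamespace false  -- the cell's namespace convention `Summit.HodgeConjecture.HodgeConjecture.Cruxes.H413.<File>` repeats the summit = problem name

noncomputable section

open MeasureTheory Measure Filter Topology NumberField NumberField.InfinitePlace NumberField.mixedEmbedding Equiv Function Set
open Literature.MeasureTheory.Group Literature.NumberTheory.Automorphic Literature.NumberTheory.Automorphic.UnitaryGroup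
open Literature.LinearAlgebra.Matrix Literature.NumberTheory.Rogawski1990
open Summit.HodgeConjecture.HodgeConjecture.Cruxes.H413.K2E4ArchPartnerWallJumpOrbitMeasure
open Summit.HodgeConjecture.HodgeConjecture.Cruxes.H413.K2E4ArchGStateStepCalculus
open scoped Matrix MatrixGroups Matrix.Norms.Operator ContDiff

namespace Summit.HodgeConjecture.HodgeConjecture.Cruxes.H413.K2E4ArchGStateStep

variable (L : Type) [Field L] [NumberField L] [IsCMField L] (α : Fin 3 → L) (w : {w : InfinitePlace L // IsComplex w})
  [MeasurableSpace (GL (Fin 3) ℂ)] [BorelSpace (GL (Fin 3) ℂ)]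

open scoped Classical in
/-- **THE `G′`-STATE ONE-STEP LAW AT `w`.**  Per-place data at `w`: Haar `ν`, the wall point `z₀` (`z₀ 0 = z₀ 2 ≠ z₀ 1`; also the reference point of the singular orbit measures), reference
centraliser measures `νH τ` on the relabelled groups `G_w(α∘τ)` (Haar, inversion invariant), and noncompact constants `c τ` with their per-partner clause `hcl` (★ G1b).  Then for every
global test function `Θ`, every family `μ_ρ` (`ρ : W → S₃`) of Radon measures on the `G_v`, every weights `a_ρ` and every even `C¹` factor `σ`, the κ-weighted state moves to the wall at
`w`: `∂_ψ[2 sin ψ · Σ_ρ (a_ρ σ ψ) · I(μ_ρ[w ↦ ν.map conj_{diag(z₀^ψ∘ρ_w)}])] ⟶ Σ_ρ a_ρ σ(0) · ℓ_ρ` along `𝓝[>] 0`, `ℓ_ρ` = ★ (R1-e′)'s wall reading of the partner `ρ_w` (compact: `2 ·` the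
orbit measure at `diag(z₀∘ρ_w)`; noncompact: `c(ρ_w) ·` the singular orbit measure). [cite: Rogawski1990, Prop. 8.2.1 (a) p. 119; §8.2 p. 124; §14.5 p. 238] [cite: Varadarajan1989, §6.4 Thm 22] -/
theorem tendsto_deriv_gState_step
    (hα : ∀ i, α i ≠ 0) (hherm : ∀ i, (IsCMField.complexConj L (α i) : L) = α i)
    (ν : Measure (archLocal L 3 (Matrix.diagonal α) w)) [ν.IsHaarMeasure] [ν.IsMulRightInvariant]
    (z₀ : Fin 3 → Circle) (h02 : z₀ 0 = z₀ 2) (h01 : z₀ 0 ≠ z₀ 1)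
    [∀ τ : Perm (Fin 3), MeasurableSpace (archLocal L 3 (Matrix.diagonal (α ∘ ⇑τ)) w ⧸ Subgroup.centralizer
      ({(⟨circleDiagonal 3 z₀, circleDiagonal_mem_archLocal_diagonal L 3 (α ∘ ⇑τ) w z₀⟩ : archLocal L 3 (Matrix.diagonal (α ∘ ⇑τ)) w)} :
        Set (archLocal L 3 (Matrix.diagonal (α ∘ ⇑τ)) w)))]
    [∀ τ : Perm (Fin 3), BorelSpace (archLocal L 3 (Matrix.diagonal (α ∘ ⇑τ)) w ⧸ Subgroup.centralizer
      ({(⟨circleDiagonal 3 z₀, circleDiagonal_mem_archLocal_diagonal L 3 (α ∘ ⇑τ) w z₀⟩ : archLocal L 3 (Matrix.diagonal (α ∘ ⇑τ)) w)} :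
        Set (archLocal L 3 (Matrix.diagonal (α ∘ ⇑τ)) w)))]
    (νH : ∀ τ : Perm (Fin 3), Measure (Subgroup.centralizer
      ({(⟨circleDiagonal 3 z₀, circleDiagonal_mem_archLocal_diagonal L 3 (α ∘ ⇑τ) w z₀⟩ : archLocal L 3 (Matrix.diagonal (α ∘ ⇑τ)) w)} :
        Set (archLocal L 3 (Matrix.diagonal (α ∘ ⇑τ)) w))))
    [∀ τ, (νH τ).IsHaarMeasure] [∀ τ, (νH τ).IsInvInvariant]
    [MeasurableSpace (arch (↥(maximalRealSubfield L)) L (IsCMField.complexConj L) 3 (Matrix.diagonal α))] [BorelSpace (arch (↥(maximalRealSubfield L)) L (IsCMField.complexConj L) 3 (Matrix.diagonal α))] :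
    -- statement-level instances for the relabelled groups `G_w(α∘σ')` and the transported Haar measures (the singular orbit measures below need them)
    haveI : ∀ σ' : Perm (Fin 3), (ν.map (ContinuousMulEquiv.restrictSubgroup (GLn.conjEquiv (Matrix.GeneralLinearGroup.mkOfDetNeZero _ (det_monomial_one_ne_zero 3 σ')))
            (archLocal L 3 (Matrix.diagonal (α ∘ ⇑σ')) w) (archLocal L 3 (Matrix.diagonal α) w)
            (mem_archLocal_comp_perm_iff_conj_mem L 3 α w σ')).symm).IsHaarMeasure := fun _ => ContinuousMulEquiv.isHaarMeasure_map ν _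
    haveI : ∀ σ' : Perm (Fin 3), SecondCountableTopology (archLocal L 3 (Matrix.diagonal (α ∘ ⇑σ')) w) := fun σ' => secondCountableTopology_archLocal L 3 (Matrix.diagonal (α ∘ ⇑σ')) w
    haveI : ∀ σ' : Perm (Fin 3), (ν.map (ContinuousMulEquiv.restrictSubgroup (GLn.conjEquiv (Matrix.GeneralLinearGroup.mkOfDetNeZero _ (det_monomial_one_ne_zero 3 σ')))
            (archLocal L 3 (Matrix.diagonal (α ∘ ⇑σ')) w) (archLocal L 3 (Matrix.diagonal α) w)
            (mem_archLocal_comp_perm_iff_conj_mem L 3 α w σ')).symm).IsMulRightInvariant := fun σ' => isMulRightInvariant_map_relabel_symm L 3 α w σ' ν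
    haveI : ∀ σ' : Perm (Fin 3), LocallyCompactSpace (archLocal L 3 (Matrix.diagonal (α ∘ ⇑σ')) w) := fun σ' => locallyCompactSpace_archLocal L 3 (Matrix.diagonal (α ∘ ⇑σ')) w
    ∀ (c : Perm (Fin 3) → ℂ)
      (hcl : ∀ (τ : Perm (Fin 3)), (w.1.embedding (α (τ⁻¹ 0))).re * (w.1.embedding (α (τ⁻¹ 2))).re < 0 →
        ∀ (Θ : Matrix (Fin 3) (Fin 3) (mixedSpace L) → ℂ), ContDiff ℝ (⊤ : ℕ∞) Θ →
          HasCompactSupport (fun g : arch (↥(maximalRealSubfield L)) L (IsCMField.complexConj L) 3 (Matrix.diagonal α) => Θ ((g : GL (Fin 3) (mixedSpace L)) : Matrix (Fin 3) (Fin 3) (mixedSpace L))) →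
          ∀ (μall : ∀ v : {w : InfinitePlace L // IsComplex w}, Measure (archLocal L 3 (Matrix.diagonal α) v)) [∀ v, IsFiniteMeasureOnCompacts (μall v)] [∀ v, SigmaFinite (μall v)],
            (∀ᶠ ψ in 𝓝[>] (0 : ℝ), DifferentiableAt ℝ (fun ψ : ℝ => (2 * Real.sin ψ : ℂ) *
                ∫ o, Θ ((((archPiEquivCM 3 L (Matrix.diagonal α)).symm o : arch (↥(maximalRealSubfield L)) L (IsCMField.complexConj L) 3 (Matrix.diagonal α)) : GL (Fin 3) (mixedSpace L)) : Matrix (Fin 3) (Fin 3) (mixedSpace L))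
                ∂(Measure.pi (Function.update μall w (ν.map fun y : archLocal L 3 (Matrix.diagonal α) w => y * (⟨circleDiagonal 3 ((fun i => z₀ i * Circle.exp (![(1 : ℝ), 0, -1] i * ψ)) ∘ ⇑(τ)), circleDiagonal_mem_archLocal_diagonal L 3 α w ((fun i => z₀ i * Circle.exp (![(1 : ℝ), 0, -1] i * ψ)) ∘ ⇑(τ))⟩ : archLocal L 3 (Matrix.diagonal α) w) * y⁻¹)))) ψ) ∧
            Tendsto (fun ψ : ℝ => deriv (fun ψ : ℝ => (2 * Real.sin ψ : ℂ) *
                ∫ o, Θ ((((archPiEquivCM 3 L (Matrix.diagonal α)).symm o : arch (↥(maximalRealSubfield L)) L (IsCMField.complexConj L) 3 (Matrix.diagonal α)) : GL (Fin 3) (mixedSpace L)) : Matrix (Fin 3) (Fin 3) (mixedSpace L))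
                ∂(Measure.pi (Function.update μall w (ν.map fun y : archLocal L 3 (Matrix.diagonal α) w => y * (⟨circleDiagonal 3 ((fun i => z₀ i * Circle.exp (![(1 : ℝ), 0, -1] i * ψ)) ∘ ⇑(τ)), circleDiagonal_mem_archLocal_diagonal L 3 α w ((fun i => z₀ i * Circle.exp (![(1 : ℝ), 0, -1] i * ψ)) ∘ ⇑(τ))⟩ : archLocal L 3 (Matrix.diagonal α) w) * y⁻¹)))) ψ) (𝓝[>] 0)
              (𝓝 (c τ * ∫ o, Θ ((((archPiEquivCM 3 L (Matrix.diagonal α)).symm o : arch (↥(maximalRealSubfield L)) L (IsCMField.complexConj L) 3 (Matrix.diagonal α)) : GL (Fin 3) (mixedSpace L)) : Matrix (Fin 3) (Fin 3) (mixedSpace L))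
                ∂(Measure.pi (Function.update μall w (((quotientMeasure _ (νH (τ)⁻¹) (isClosed_coe_centralizer_singleton _) (ν.map (ContinuousMulEquiv.restrictSubgroup (GLn.conjEquiv (Matrix.GeneralLinearGroup.mkOfDetNeZero _ (det_monomial_one_ne_zero 3 (τ)⁻¹)))
              (archLocal L 3 (Matrix.diagonal (α ∘ ⇑(τ)⁻¹)) w) (archLocal L 3 (Matrix.diagonal α) w)
              (mem_archLocal_comp_perm_iff_conj_mem L 3 α w (τ)⁻¹)).symm)).map
                  (descConj (⟨circleDiagonal 3 z₀, circleDiagonal_mem_archLocal_diagonal L 3 (α ∘ ⇑(τ)⁻¹) w z₀⟩ : archLocal L 3 (Matrix.diagonal (α ∘ ⇑(τ)⁻¹)) w)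
                    (Subgroup.centralizer ({(⟨circleDiagonal 3 z₀, circleDiagonal_mem_archLocal_diagonal L 3 (α ∘ ⇑(τ)⁻¹) w z₀⟩ :
                      archLocal L 3 (Matrix.diagonal (α ∘ ⇑(τ)⁻¹)) w)} : Set (archLocal L 3 (Matrix.diagonal (α ∘ ⇑(τ)⁻¹)) w)))
                    (forall_mem_centralizer_circleDiagonal_comm_of_wall L (α ∘ ⇑(τ)⁻¹) w h02 h01 h02 h01) id)).map
                  (ContinuousMulEquiv.restrictSubgroup (GLn.conjEquiv (Matrix.GeneralLinearGroup.mkOfDetNeZero _ (det_monomial_one_ne_zero 3 (τ)⁻¹)))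
              (archLocal L 3 (Matrix.diagonal (α ∘ ⇑(τ)⁻¹)) w) (archLocal L 3 (Matrix.diagonal α) w)
              (mem_archLocal_comp_perm_iff_conj_mem L 3 α w (τ)⁻¹))))))))
      (Θ : Matrix (Fin 3) (Fin 3) (mixedSpace L) → ℂ) (hΘ : ContDiff ℝ (⊤ : ℕ∞) Θ)
      (hΘc : HasCompactSupport (fun g : arch (↥(maximalRealSubfield L)) L (IsCMField.complexConj L) 3 (Matrix.diagonal α) => Θ ((g : GL (Fin 3) (mixedSpace L)) : Matrix (Fin 3) (Fin 3) (mixedSpace L))))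
      (μ : ({w : InfinitePlace L // IsComplex w} → Perm (Fin 3)) → ∀ v : {w : InfinitePlace L // IsComplex w}, Measure (archLocal L 3 (Matrix.diagonal α) v))
      (hμ : ∀ ρ v, IsFiniteMeasureOnCompacts (μ ρ v) ∧ SigmaFinite (μ ρ v))
      (a : ({w : InfinitePlace L // IsComplex w} → Perm (Fin 3)) → ℂ) (σ : ℝ → ℂ) (hσ : ContDiff ℝ 1 σ) (heven : ∀ x, σ (-x) = σ x)
      (ℓ : ({w : InfinitePlace L // IsComplex w} → Perm (Fin 3)) → ℂ)
      (hℓc : ∀ ρ, 0 < (w.1.embedding (α ((ρ w)⁻¹ 0))).re * (w.1.embedding (α ((ρ w)⁻¹ 2))).re → ℓ ρ =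
            2 * ∫ o, Θ ((((archPiEquivCM 3 L (Matrix.diagonal α)).symm o : arch (↥(maximalRealSubfield L)) L (IsCMField.complexConj L) 3 (Matrix.diagonal α)) : GL (Fin 3) (mixedSpace L)) : Matrix (Fin 3) (Fin 3) (mixedSpace L))
                ∂(Measure.pi (Function.update (μ ρ) w (ν.map fun y : archLocal L 3 (Matrix.diagonal α) w => y * (⟨circleDiagonal 3 (z₀ ∘ ⇑(ρ w)), circleDiagonal_mem_archLocal_diagonal L 3 α w (z₀ ∘ ⇑(ρ w))⟩ : archLocal L 3 (Matrix.diagonal α) w) * y⁻¹))))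
      (hℓn : ∀ ρ, (w.1.embedding (α ((ρ w)⁻¹ 0))).re * (w.1.embedding (α ((ρ w)⁻¹ 2))).re < 0 → ℓ ρ =
            c (ρ w) * ∫ o, Θ ((((archPiEquivCM 3 L (Matrix.diagonal α)).symm o : arch (↥(maximalRealSubfield L)) L (IsCMField.complexConj L) 3 (Matrix.diagonal α)) : GL (Fin 3) (mixedSpace L)) : Matrix (Fin 3) (Fin 3) (mixedSpace L))
                ∂(Measure.pi (Function.update (μ ρ) w (((quotientMeasure _ (νH (ρ w)⁻¹) (isClosed_coe_centralizer_singleton _) (ν.map (ContinuousMulEquiv.restrictSubgroup (GLn.conjEquiv (Matrix.GeneralLinearGroup.mkOfDetNeZero _ (det_monomial_one_ne_zero 3 (ρ w)⁻¹)))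
              (archLocal L 3 (Matrix.diagonal (α ∘ ⇑(ρ w)⁻¹)) w) (archLocal L 3 (Matrix.diagonal α) w)
              (mem_archLocal_comp_perm_iff_conj_mem L 3 α w (ρ w)⁻¹)).symm)).map
                  (descConj (⟨circleDiagonal 3 z₀, circleDiagonal_mem_archLocal_diagonal L 3 (α ∘ ⇑(ρ w)⁻¹) w z₀⟩ : archLocal L 3 (Matrix.diagonal (α ∘ ⇑(ρ w)⁻¹)) w)
                    (Subgroup.centralizer ({(⟨circleDiagonal 3 z₀, circleDiagonal_mem_archLocal_diagonal L 3 (α ∘ ⇑(ρ w)⁻¹) w z₀⟩ :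
                      archLocal L 3 (Matrix.diagonal (α ∘ ⇑(ρ w)⁻¹)) w)} : Set (archLocal L 3 (Matrix.diagonal (α ∘ ⇑(ρ w)⁻¹)) w)))
                    (forall_mem_centralizer_circleDiagonal_comm_of_wall L (α ∘ ⇑(ρ w)⁻¹) w h02 h01 h02 h01) id)).map
                  (ContinuousMulEquiv.restrictSubgroup (GLn.conjEquiv (Matrix.GeneralLinearGroup.mkOfDetNeZero _ (det_monomial_one_ne_zero 3 (ρ w)⁻¹)))
              (archLocal L 3 (Matrix.diagonal (α ∘ ⇑(ρ w)⁻¹)) w) (archLocal L 3 (Matrix.diagonal α) w)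
              (mem_archLocal_comp_perm_iff_conj_mem L 3 α w (ρ w)⁻¹))))))
      (Bfun : ℝ → ℂ)
      (hB : ∀ ψ : ℝ, Bfun ψ =
        ∑ ρ : {w : InfinitePlace L // IsComplex w} → Perm (Fin 3), (a ρ * σ ψ) *
          (∫ o, Θ ((((archPiEquivCM 3 L (Matrix.diagonal α)).symm o : arch (↥(maximalRealSubfield L)) L (IsCMField.complexConj L) 3 (Matrix.diagonal α)) : GL (Fin 3) (mixedSpace L)) : Matrix (Fin 3) (Fin 3) (mixedSpace L))
              ∂(Measure.pi (Function.update (μ ρ) w (ν.map fun y : archLocal L 3 (Matrix.diagonal α) w => y * (⟨circleDiagonal 3 ((fun i => z₀ i * Circle.exp (![(1 : ℝ), 0, -1] i * ψ)) ∘ ⇑(ρ w)), circleDiagonal_mem_archLocal_diagonal L 3 α w ((fun i => z₀ i * Circle.exp (![(1 : ℝ), 0, -1] i * ψ)) ∘ ⇑(ρ w))⟩ : archLocal L 3 (Matrix.diagonal α) w) * y⁻¹))))),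
    Tendsto (fun ψ : ℝ => deriv (fun ψ : ℝ => (2 * Real.sin ψ : ℂ) *
        Bfun ψ) ψ) (𝓝[>] 0)
      (𝓝 (∑ ρ : {w : InfinitePlace L // IsComplex w} → Perm (Fin 3), a ρ * σ 0 * ℓ ρ)) := by
  intro c hcl Θ hΘ hΘc μ hμ a σ hσ heven ℓ hℓc hℓn Bfun hB
  have hBf : Bfun = fun ψ : ℝ =>
        ∑ ρ : {w : InfinitePlace L // IsComplex w} → Perm (Fin 3), (a ρ * σ ψ) *
          (∫ o, Θ ((((archPiEquivCM 3 L (Matrix.diagonal α)).symm o : arch (↥(maximalRealSubfield L)) L (IsCMField.complexConj L) 3 (Matrix.diagonal α)) : GL (Fin 3) (mixedSpace L)) : Matrix (Fin 3) (Fin 3) (mixedSpace L))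
              ∂(Measure.pi (Function.update (μ ρ) w (ν.map fun y : archLocal L 3 (Matrix.diagonal α) w => y * (⟨circleDiagonal 3 ((fun i => z₀ i * Circle.exp (![(1 : ℝ), 0, -1] i * ψ)) ∘ ⇑(ρ w)), circleDiagonal_mem_archLocal_diagonal L 3 α w ((fun i => z₀ i * Circle.exp (![(1 : ℝ), 0, -1] i * ψ)) ∘ ⇑(ρ w))⟩ : archLocal L 3 (Matrix.diagonal α) w) * y⁻¹)))) := funext hB
  subst hBf
  classical
  -- the jump functions `I_ρ` and their limits `ℓ_ρ`, then ★ G3-calc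
  refine tendsto_deriv_two_sin_mul_sum_flat_mul (Finset.univ : Finset ({w : InfinitePlace L // IsComplex w} → Perm (Fin 3))) _ _
    a hσ heven (fun ρ _ => ?_) (fun ρ _ => ?_)
  · -- differentiability on the window (★ G1b, both wall types)
    haveI : ∀ v, IsFiniteMeasureOnCompacts (μ ρ v) := fun v => (hμ ρ v).1
    haveI : ∀ v, SigmaFinite (μ ρ v) := fun v => (hμ ρ v).2
    by_cases hcw : 0 < (w.1.embedding (α ((ρ w)⁻¹ 0))).re * (w.1.embedding (α ((ρ w)⁻¹ 2))).re
    · exact (tendsto_deriv_wallJump_partner_compact_orbitMeasure L α w hα hherm ν Θ hΘ hΘc (μ ρ) z₀ h02 h01 (ρ w) hcw).1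
    · have hne : ∀ i : Fin 3, (w.1.embedding (α i)).re ≠ 0 :=
        re_embedding_ne_zero L 3 α w hα fun i => im_embedding_eq_zero_of_complexConj_eq L w (hherm i)
      have hτ : (w.1.embedding (α ((ρ w)⁻¹ 0))).re * (w.1.embedding (α ((ρ w)⁻¹ 2))).re < 0 :=
        lt_of_le_of_ne (not_lt.mp hcw) (mul_ne_zero (hne _) (hne _))
      exact (hcl (ρ w) hτ Θ hΘ hΘc (μ ρ)).1
  · -- the limit (★ G1b by wall type)
    haveI : ∀ v, IsFiniteMeasureOnCompacts (μ ρ v) := fun v => (hμ ρ v).1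
    haveI : ∀ v, SigmaFinite (μ ρ v) := fun v => (hμ ρ v).2
    by_cases hcw : 0 < (w.1.embedding (α ((ρ w)⁻¹ 0))).re * (w.1.embedding (α ((ρ w)⁻¹ 2))).re
    · rw [hℓc ρ hcw]
      exact (tendsto_deriv_wallJump_partner_compact_orbitMeasure L α w hα hherm ν Θ hΘ hΘc (μ ρ) z₀ h02 h01 (ρ w) hcw).2
    · have hne : ∀ i : Fin 3, (w.1.embedding (α i)).re ≠ 0 :=
        re_embedding_ne_zero L 3 α w hα fun i => im_embedding_eq_zero_of_complexConj_eq L w (hherm i)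
      have hτ : (w.1.embedding (α ((ρ w)⁻¹ 0))).re * (w.1.embedding (α ((ρ w)⁻¹ 2))).re < 0 :=
        lt_of_le_of_ne (not_lt.mp hcw) (mul_ne_zero (hne _) (hne _))
      rw [hℓn ρ hτ]
      exact (hcl (ρ w) hτ Θ hΘ hΘc (μ ρ)).2

end Summit.HodgeConjecture.HodgeConjecture.Cruxes.H413.K2E4ArchGStateStep

end
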